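import Literature.NumberTheory.EllipticCurves.JZeroCMReductionFrobeniusFlip
import Literature.NumberTheory.EllipticCurves.MordellCurveTorsionDividesSix
import Literature.NumberTheory.EllipticCurves.ComplexMultiplicationDeuring0Square
import Literature.NumberTheory.EllipticCurves.HuShuYin2019.SylvesterThreePart
import HarnessLib

/-!
# The minimal model `y² + y = x³ − 1` of `E_9 : x³ + y³ = 9` and its reduction frame at the
# Kolyvagin primes `ℓ ≡ 2 (mod 3)`

Topic `NumberTheory/EllipticCurves/HuShuYin2019`; namespace
`Literature.NumberTheory.EllipticCurves.HuShuYin2019`.  THEOREMS ONLY (D-0026: no definition, no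
named fact, no instance, no `sorry`).

Hu–Shu–Yin's curve `E_9` (the CM curve of the frame `E_9 ≅ E_p ≅ E_{3p²}` over `K(∛p, ∛3)`,
§2: *"a modular parametrization `X₀(3⁵) → E_9`"*) is used in the tree through the short model
`cubeSumCurve 9 : y² = x³ − 432·9²` (`SylvesterThreePart`; Hu–Shu–Yin p. 4: *"`E_n` has Weierstrass
equation `y² = x³ − 432n²`"*).  That equation is not minimal (at `2` and at `3`:
`Δ = −2¹²·3¹⁷`).  This file records, as theorems about the literal equation
`⟨0, 0, 1, 0, −1⟩ : WeierstrassCurve ℚ` (`y² + y = x³ − 1`, discriminant `−3⁵ = −243`, `j = 0`):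

* `variableChange_six_smul_cubeSumCurve_nine` — the change of variables
  `(u, r, s, t) = (6, 0, 0, 108)` takes `cubeSumCurve 9` to `y² + y = x³ − 1`
  (`a₃' = 2t/u³ = 1`, `a₆' = (a₆ − t²)/u⁶ = (−34992 − 11664)/46656 = −1`; Silverman, *AEC*, III.1
  Table 3.1);
* `Δ_sylvesterNineMinimal` (`Δ = −243`), `isElliptic_sylvesterNineMinimal`,
  `c₄_sylvesterNineMinimal` / `j_sylvesterNineMinimal` (`c₄ = 0`, `j = 0`);
* `isGloballyMinimal_sylvesterNineMinimal` — **`y² + y = x³ − 1` is a global minimal model**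
  (`ord_q Δ ≤ 5 < 12` at every prime; the tree's `MordellTorsion.isGloballyMinimal_E'`, Kraus /
  Silverman VII.1 Rem. 1.1, VIII.8), stated as a theorem (use `haveI`);
* `minimalDiscriminantInt_sylvesterNineMinimal` (`= −243`) and
  `not_dvd_minimalDiscriminantInt_sylvesterNineMinimal` (`ℓ ∤ Δ_min` for every prime `ℓ ≠ 3`:
  good reduction away from `3`);
* `frobeniusTrace_sylvesterNineMinimal_eq_zero` — **`a_ℓ(E_9) = 0` for every prime
  `ℓ ≡ 2 (mod 3)`, `ℓ ≠ 2`** (supersingular reduction of a `j = 0` curve at a prime inert in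
  `ℚ(ω)`; the tree's `frobeniusTrace_eq_zero_of_j_eq_zero_of_mod_three_eq_two`, Ireland–Rosen
  Ch. 18 §3 Thm. 4);
* `exists_frameTransport_cubeSumCurve_nine` — over any field `K` of characteristic `0`, the
  `Γ_K`-equivariant transport `κ : E_9(K̄) ≃+ W₀(K̄)` from the short model to the minimal one,
  diagonal on `x` (`JZero.exists_frameTransport` with `r = s = 0`);
* `sylvesterNine_reductionFrame` — the bundle of hypotheses `hΔ`, `h₁ h₂ h₄` (`a₁ = a₂ = a₄ = 0`),
  `a_ℓ = 0` under which the tree's reduction datum of a globally minimal `ℚ`-model at a supersingular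
  Kolyvagin prime and the `j = 0` reduction dictionary (`JZeroCMReductionFrobeniusFlip` §§5–6) are
  instantiated at `W₀ = (y² + y = x³ − 1)`.

Nothing here asserts anything about Selmer groups, the Sylvester conjecture or BSD.

## References

* [HuShuYin2019] Y. Hu, J. Shu, H. Yin, *An explicit Gross–Zagier formula related to the Sylvester
  conjecture*, Trans. AMS 372 (2019): §1 p. 4 (`E_n : y² = x³ − 432n²`), §2 (`X₀(3⁵) → E_9`).
* [SilvermanAEC2009] J. H. Silverman, *The Arithmetic of Elliptic Curves*, 2nd ed.: III.1 Table 3.1,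
  VII.1 Remark 1.1, VIII.8 (global minimal models).
* [Kraus1989] A. Kraus, *Quelques remarques à propos des invariants c₄, c₆ et Δ d'une courbe
  elliptique*, Acta Arith. 54 (1989), Prop. 2 (through the tree's `isGloballyMinimal_of_int_kraus`).
* [IrelandRosen1990] K. Ireland, M. Rosen, *A Classical Introduction to Modern Number Theory*,
  Ch. 18 §3 Thm. 4 (`N_p = p + 1` for `y² = x³ + D`, `p ≡ 2 (mod 3)`).
-/

noncomputable section

open scoped Classical
open WeierstrassCurve Field

universe u

namespace Literature.NumberTheory.EllipticCurves.HuShuYin2019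

/-! ## §1 The change of variables and the invariants of `y² + y = x³ − 1` -/

/-- **`(6, 0, 0, 108) • (y² = x³ − 432·81) = (y² + y = x³ − 1)`**: `a₃' = 2t/u³ = 216/216 = 1`,
`a₆' = (a₆ − t²)/u⁶ = (−34992 − 11664)/46656 = −1`, the other coefficients stay `0` (`r = s = 0`).
[cite: SilvermanAEC2009, III.1 (Table 3.1)] [cite: HuShuYin2019, §1 p. 4] -/
theorem variableChange_six_smul_cubeSumCurve_nine :
    (⟨Units.mk0 (6 : ℚ) (by norm_num), 0, 0, 108⟩ : VariableChange ℚ) • cubeSumCurve 9 =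
      ⟨0, 0, 1, 0, -1⟩ := by
  ext
  · simp [cubeSumCurve, variableChange_a₁]
  · simp [cubeSumCurve, variableChange_a₂]
  · simp [cubeSumCurve, variableChange_a₃]
    norm_num
  · simp [cubeSumCurve, variableChange_a₄]
  · simp [cubeSumCurve, variableChange_a₆]
    norm_num

/-- `Δ(y² + y = x³ − 1) = −27·(4·(−1) + 1)² = −243 = −3⁵`. [cite: SilvermanAEC2009, III.1 (b₂, b₄, b₆, b₈, Δ)] -/
theorem Δ_sylvesterNineMinimal : (⟨0, 0, 1, 0, -1⟩ : WeierstrassCurve ℚ).Δ = -243 := by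
  simp only [WeierstrassCurve.Δ, WeierstrassCurve.b₂, WeierstrassCurve.b₄, WeierstrassCurve.b₆,
    WeierstrassCurve.b₈]
  norm_num

/-- `c₄(y² + y = x³ − 1) = 0` (all of `a₁, a₂, a₄` vanish). [cite: SilvermanAEC2009, III.1 (c₄)] -/
theorem c₄_sylvesterNineMinimal : (⟨0, 0, 1, 0, -1⟩ : WeierstrassCurve ℚ).c₄ = 0 := by
  simp [WeierstrassCurve.c₄, WeierstrassCurve.b₂, WeierstrassCurve.b₄]

/-- `y² + y = x³ − 1` is an elliptic curve (`Δ = −243 ≠ 0`). [cite: SilvermanAEC2009, III.1 Prop. 1.4] -/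
theorem isElliptic_sylvesterNineMinimal : (⟨0, 0, 1, 0, -1⟩ : WeierstrassCurve ℚ).IsElliptic :=
  ⟨by rw [Δ_sylvesterNineMinimal]; exact isUnit_iff_ne_zero.mpr (by norm_num)⟩

/-- `j(y² + y = x³ − 1) = 0` (`c₄ = 0`; for any ellipticity witness). [cite: SilvermanAEC2009, III.1 (j = c₄³/Δ)] -/
theorem j_sylvesterNineMinimal [(⟨0, 0, 1, 0, -1⟩ : WeierstrassCurve ℚ).IsElliptic] :
    (⟨0, 0, 1, 0, -1⟩ : WeierstrassCurve ℚ).j = 0 :=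
  WeierstrassCurve.j_eq_zero _ c₄_sylvesterNineMinimal

/-! ## §2 Global minimality, the minimal discriminant, good and supersingular reduction -/

/-- **`y² + y = x³ − 1` is a global minimal Weierstrass equation** (integral, `Δ = −3⁵` with
`ord_q Δ ≤ 5 < 12` at every prime `q`: Silverman VII.1 Remark 1.1 at each prime, VIII.8; the tree's
`MordellTorsion.isGloballyMinimal_E'` for `c = −1`, `4c + 1 = −3` sixth-power-free).  A theorem, not
an instance: use `haveI`. [cite: SilvermanAEC2009, VII.1 Remark 1.1, VIII.8] [cite: Kraus1989, Prop. 2] -/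
theorem isGloballyMinimal_sylvesterNineMinimal :
    (⟨0, 0, 1, 0, -1⟩ : WeierstrassCurve ℚ).IsGloballyMinimal := by
  have h := MordellTorsion.isGloballyMinimal_E' (c := -1) (by norm_num) (fun p hp hdvd ↦ by
    have h' : p ^ 6 ∣ 3 := by
      have := Int.natAbs_dvd_natAbs.mpr hdvd
      simpa [Int.natAbs_pow] using this
    have h6 := Nat.le_of_dvd (by norm_num) h'
    have h2 : 2 ^ 6 ≤ p ^ 6 := Nat.pow_le_pow_left hp.two_le 6
    omega)
  have e : (⟨((0 : ℤ) : ℚ), ((0 : ℤ) : ℚ), ((1 : ℤ) : ℚ), ((0 : ℤ) : ℚ), ((-1 : ℤ) : ℚ)⟩ :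
      WeierstrassCurve ℚ) = ⟨0, 0, 1, 0, -1⟩ := by
    push_cast
    rfl
  rw [e] at h
  exact h

/-- The minimal discriminant of `E_9` is `−243 = −3⁵`. [cite: SilvermanAEC2009, VIII.8 (minimal discriminant)] -/
theorem minimalDiscriminantInt_sylvesterNineMinimal
    [(⟨0, 0, 1, 0, -1⟩ : WeierstrassCurve ℚ).IsGloballyMinimal] :
    minimalDiscriminantInt (⟨0, 0, 1, 0, -1⟩ : WeierstrassCurve ℚ) = -243 := by
  have h := cast_minimalDiscriminantInt (⟨0, 0, 1, 0, -1⟩ : WeierstrassCurve ℚ)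
  rw [Δ_sylvesterNineMinimal] at h
  exact_mod_cast h

/-- **Good reduction of `E_9` away from `3`**: a prime `ℓ ≠ 3` does not divide the minimal
discriminant `−3⁵`. [cite: SilvermanAEC2009, VII.5 Prop. 5.1 (a)] [cite: HuShuYin2019, §2 (conductor 3⁵)] -/
theorem not_dvd_minimalDiscriminantInt_sylvesterNineMinimal
    [(⟨0, 0, 1, 0, -1⟩ : WeierstrassCurve ℚ).IsGloballyMinimal] {ℓ : ℕ} (hℓ : ℓ.Prime)
    (h3 : ℓ ≠ 3) : ¬ (ℓ : ℤ) ∣ minimalDiscriminantInt (⟨0, 0, 1, 0, -1⟩ : WeierstrassCurve ℚ) := by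
  rw [minimalDiscriminantInt_sylvesterNineMinimal]
  intro h
  have h' : ℓ ∣ 3 ^ 5 := by
    have := Int.natAbs_dvd_natAbs.mpr h
    simpa using this
  exact h3 ((Nat.prime_dvd_prime_iff_eq hℓ Nat.prime_three).mp (hℓ.dvd_of_dvd_pow h'))

/-- **`a_ℓ(E_9) = 0` at every prime `ℓ ≡ 2 (mod 3)`, `ℓ ≠ 2`** (supersingular reduction of the
`j = 0` curve `E_9` at the primes inert in `ℚ(ω)`; the tree's
`frobeniusTrace_eq_zero_of_j_eq_zero_of_mod_three_eq_two`).  These are exactly the Kolyvagin primes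
of the CM frame at `p = 2`. [cite: IrelandRosen1990, Ch. 18 §3, Theorem 4] -/
theorem frobeniusTrace_sylvesterNineMinimal_eq_zero [(⟨0, 0, 1, 0, -1⟩ : WeierstrassCurve ℚ).IsElliptic]
    [(⟨0, 0, 1, 0, -1⟩ : WeierstrassCurve ℚ).IsGloballyMinimal] {ℓ : ℕ} (hℓ : ℓ.Prime)
    (hℓ3 : ℓ % 3 = 2) (h2 : ℓ ≠ 2) :
    (⟨0, 0, 1, 0, -1⟩ : WeierstrassCurve ℚ).frobeniusTrace ℓ = 0 :=
  frobeniusTrace_eq_zero_of_j_eq_zero_of_mod_three_eq_two _ j_sylvesterNineMinimal hℓ hℓ3 h2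
    (not_dvd_minimalDiscriminantInt_sylvesterNineMinimal hℓ (by rintro rfl; norm_num at hℓ3))

/-! ## §3 The reduction frame of `E_9` over `K` -/

/-- **The frame transport `E_9(K̄) ≃+ W₀(K̄)`** from the short model `(cubeSumCurve 9)_K` to the
minimal model `W₀ = (y² + y = x³ − 1)_K`, over any field `K` of characteristic `0`: `Γ_K`-equivariant
and diagonal on `x`, `κ(x, y) = (x/36, y/216 − 1/2)` (`JZero.exists_frameTransport` for the change of
variables `(6, 0, 0, 108)` read in `K`). [cite: SilvermanAEC2009, III.1 (Table 3.1), III.3.1(b)]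
[cite: HuShuYin2019, §2 p. 8] -/
theorem exists_frameTransport_cubeSumCurve_nine (K : Type u) [Field K] [CharZero K] :
    ∃ κ : geomPoints ((cubeSumCurve 9).baseChange K) ≃+
        geomPoints ((⟨0, 0, 1, 0, -1⟩ : WeierstrassCurve ℚ).baseChange K),
      (∀ (g : absoluteGaloisGroup K) (P : geomPoints ((cubeSumCurve 9).baseChange K)),
        κ (g • P) = g • κ P) ∧
      ∃ a b d : AlgebraicClosure K, a ≠ 0 ∧
        ∀ {x y : AlgebraicClosure K}
          (h : (((cubeSumCurve 9).baseChange K).baseChange (AlgebraicClosure K)).toAffine.Nonsingular x y),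
          ∃ h', κ (.some x y h) = .some (a * x) (b * y + d) h' := by
  set C₀ : VariableChange ℚ := ⟨Units.mk0 (6 : ℚ) (by norm_num), 0, 0, 108⟩ with hC₀
  have hC : (C₀.map (algebraMap ℚ K)) • (cubeSumCurve 9).baseChange K =
      (⟨0, 0, 1, 0, -1⟩ : WeierstrassCurve ℚ).baseChange K := by
    rw [← VariableChange.baseChange_smul_eq, hC₀, variableChange_six_smul_cubeSumCurve_nine]
  exact JZero.exists_frameTransport (C := C₀.map (algebraMap ℚ K))
    (by simp [hC₀, VariableChange.map]) (by simp [hC₀, VariableChange.map]) hC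

/-- **The reduction frame of `E_9` at a Kolyvagin prime of the CM frame** (`ℓ` prime,
`ℓ ≡ 2 (mod 3)`, `ℓ ≠ 2`): for the minimal model `W₀ = (y² + y = x³ − 1)` — `ℓ ∤ Δ_min(W₀)`,
`a₁ = a₂ = a₄ = 0`, `a_ℓ(W₀) = 0`; the hypotheses `hΔ`, `h₁ h₂ h₄`, `ha0` at which the tree's
supersingular reduction datum of a globally minimal `ℚ`-model and the `j = 0` reduction dictionary
(`JZero.exists_reduced_mulX_frame`) are instantiated, the frame transport being
`exists_frameTransport_cubeSumCurve_nine`. [cite: HuShuYin2019, §1 p. 4, §2]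
[cite: IrelandRosen1990, Ch. 18 §3, Theorem 4] [cite: SilvermanAEC2009, VIII.8] -/
theorem sylvesterNine_reductionFrame [(⟨0, 0, 1, 0, -1⟩ : WeierstrassCurve ℚ).IsElliptic]
    [(⟨0, 0, 1, 0, -1⟩ : WeierstrassCurve ℚ).IsGloballyMinimal] {ℓ : ℕ} (hℓ : ℓ.Prime)
    (hℓ3 : ℓ % 3 = 2) (h2 : ℓ ≠ 2) :
    ¬ (ℓ : ℤ) ∣ minimalDiscriminantInt (⟨0, 0, 1, 0, -1⟩ : WeierstrassCurve ℚ) ∧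
      (⟨0, 0, 1, 0, -1⟩ : WeierstrassCurve ℚ).a₁ = 0 ∧ (⟨0, 0, 1, 0, -1⟩ : WeierstrassCurve ℚ).a₂ = 0 ∧
      (⟨0, 0, 1, 0, -1⟩ : WeierstrassCurve ℚ).a₄ = 0 ∧
      (⟨0, 0, 1, 0, -1⟩ : WeierstrassCurve ℚ).frobeniusTrace ℓ = 0 :=
  ⟨not_dvd_minimalDiscriminantInt_sylvesterNineMinimal hℓ (by rintro rfl; norm_num at hℓ3), rfl, rfl,
    rfl, frobeniusTrace_sylvesterNineMinimal_eq_zero hℓ hℓ3 h2⟩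

end Literature.NumberTheory.EllipticCurves.HuShuYin2019

end
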